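import Summits.ResolutionOfSingularities.ResolutionOfSingularities.Theorems.EquisingularLiftEquisingularLiftNatPointStepGoodSet
import Summits.ResolutionOfSingularities.ResolutionOfSingularities.Theorems.EquisingularLiftEquisingularLiftNatPointExit
import Summits.ResolutionOfSingularities.ResolutionOfSingularities.Theorems.EquisingularLiftEquisingularLiftNatPointResolvableAnywhere
import HarnessLib

/-!
# [OURS · L1 W4.5(b) · EL♮] PIECE B1 «GOOD-POINT FINISH» OF THE POINT-EXIT CUT — `GoodPointFinish p` holds for every `p`
# (crux `EquisingularLiftNat` = stmt-ResolutionOfSingularities-20038; res-L1-w45b-strat-1's typed target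
# Theorems/EquisingularLiftEquisingularLiftNatPointExit.lean p529105, TARGET-GoodPointFinish.md bfd46c0f56729039)

HONEST FRAMING. OURS (cell res-hironaka, crux chain w45b, slot W4.5(b)); NOT a statement of any manuscript; replaces the role of NOTHING
in the manuscript; AI-written, AI review is weaker than expert review. Helper `--supports stmt-ResolutionOfSingularities-20038 --as helper`
by res-L1-w45b-lead-1. No `sorry`; standard axioms.

WHAT THIS FILE PROVES.
* `pointResolution_from_stage_of_goodSet` — T-ISO-0-REL (`pointResolution_from_stage`, res-type-022 p509452) IN `GoodSet` CURRENCY: over a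
  complete DVR with algebraically closed residue field, a smooth proper INTEGRAL ambient `q : P → Spec O`, `Y` closed irreducible in the
  special fibre, a stage predicate `Ch` refining `Split.Chain` and closed under the horizontal E1 steps; a `Ch`-stage `(X₁, σ₁, S₁)`
  with `GoodSet (σ₁ ≫ q) S₁` (good reduction of the ambient at the NON-REGULAR points of `V(closure S₁)_red` — the 08-17 clause, nothing
  at the other points, no irreducibility of the special fibre) whose reduced strict transform is isomorphic to a point-resolvable
  `V(closure T₀)_red ⊆ F₀` has a `Ch`-continuation with `GoodSet` and REGULAR reduced strict transform. The downstairs induction of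
  `pointResolution_from_stage` verbatim, the step being `pointStep_of_goodSet` (Theorems/…NatPointStepGoodSet.lean).
* `goodPointFinish_holds (p) : GoodPointFinish p` — strat-1's piece B1 BY NAME: unpack `GoodPointFinishAt` / `ExitAt` / `PtResolvable`;
  the residue field of `O` is algebraically closed (`π : O ↠ k`, `isAlgClosed_residueField_of_surjective`); `Y = range (ι ≫ Proj.map φ)`
  is closed irreducible inside the special fibre of the smooth proper integral `ℙⁿ_O` (`ProjectiveAmbientFibre.isPullback_projMap`,
  `stub_projectiveAmbientSmoothProper`, `Proj.isIntegral`); the downstairs `T₀` is irreducible because `V(closure T₀)_red ≅ V(closure S₁)_red`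
  and `closure S₁ = closure {ξ₁}` along the chain (`Chain.fibre`); then `pointResolution_from_stage_of_goodSet` with the stage predicate
  «`HReach` from the base AND from the stage» (the device of `finish_of_exit_of_goodAll`).

CONSEQUENCE (not restated here): with `stub_elnat_ge_four_finish_of_exit p (goodPointFinish_holds p)` the registered stub
`stub_elnat_ge_four_finish : GeFourFinishIsolated p` of the crux skeleton is REDUCED to piece B2 `GeFourReachExitIsolated p`
(`geFourFinishIsolated_iff_geFourReachExitIsolated_of_goodPointFinish`), and `equisingularLiftNat_of_reachExit_of_goodPointFinish`
needs only `∀ p, ReachExit p`.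

References: Theorems/EquisingularLiftEquisingularLiftNatPointStepGoodSet.lean, …NatPointResolutionRel.lean (copied induction),
…NatPointExit.lean (the target and `finish_of_exit_of_goodAll`), …NatPointResolution.lean (base facts at `ℙⁿ_O`, copied),
…NatPointResolvableAnywhere.lean (`isAlgClosed_residueField_of_surjective`); Liu 2002 §8.1, §8.3.4.
-/

set_option linter.dupNamespace false -- mandated namespace `Summit.<Summit>.<Problem>` of this single-conjunct summit
set_option linter.overlappingInstances false -- signatures carry `[IsDomain O] [IsDiscreteValuationRing O]`

noncomputable section

open CategoryTheory CategoryTheory.Limits AlgebraicGeometry TopologicalSpace Topology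
open Literature.AlgebraicGeometry.Resolution
open AlgebraicGeometry.Scheme.IdealSheafData
open Summit.ResolutionOfSingularities.ResolutionOfSingularities.Theses.EquisingularLift.Split
open Summit.ResolutionOfSingularities.ResolutionOfSingularities.Cruxes.EquisingularLift.StrataSplit
open Summit.ResolutionOfSingularities.ResolutionOfSingularities.Theorems.EquisingularLift
open Summit.ResolutionOfSingularities.ResolutionOfSingularities.Theorems.EquisingularLiftNatStageCut
open Summit.ResolutionOfSingularities.ResolutionOfSingularities.Theorems.EquisingularLiftNatPointExit

namespace Summit.ResolutionOfSingularities.ResolutionOfSingularities.Cruxes.EquisingularLiftNat.Sections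

/-! ## T-ISO-0-REL in `GoodSet` currency -/

/-- **T-ISO-0-REL IN `GoodSet` CURRENCY: point-resolvable downstairs ⇒ a `Ch`-continuation with regular reduced strict transform.**
`pointResolution_from_stage` (p509452) with the stage invariant «irreducible special fibre ∧ good reduction at every special point»
replaced by `GoodSet` (good reduction of the ambient at the non-regular points of the reduced strict transform), the step being
`pointStep_of_goodSet`; the base `P` integral. The downstairs induction is unchanged: motive `QD F₁ ρ T₁ :=` «`T₁` closed irreducible,
`F₁` locally Noetherian, and some `Ch`-stage with `GoodSet` has reduced strict transform isomorphic to `V(closure T₁)_red`».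
[folklore; Liu 2002 §8.1, §8.3.4] -/
theorem pointResolution_from_stage_of_goodSet (O : Type) [CommRing O] [IsDomain O] [IsDiscreteValuationRing O]
    [IsAdicComplete (IsLocalRing.maximalIdeal O) O] [IsAlgClosed (IsLocalRing.ResidueField O)]
    (P : Scheme.{0}) [IsIntegral P] (q : P ⟶ Spec (.of O)) (Y : Closeds P)
    (Ch : ∀ X' : Scheme.{0}, (X' ⟶ P) → Set X' → Prop)
    (hChain : ∀ (X' : Scheme.{0}) (σ : X' ⟶ P) (S : Set X'), Ch X' σ S → Chain P (Y : Set P) X' σ S)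
    (hStep : ∀ (X' X'' : Scheme.{0}) (σ' : X' ⟶ P) (S' : Set X') (C : X'.IdealSheafData) (τ : X'' ⟶ X'),
      Ch X' σ' S' → IsBlowup τ C → Scheme.IsRegular C.subscheme → Flat (C.subschemeι ≫ σ' ≫ q) →
      σ' '' (C.support : Set X') ⊆ {x : P | ¬ IsGenericPoint x (Y : Set P)} →
      (C.support : Set X') ∩ (σ' ≫ q) ⁻¹' {IsLocalRing.closedPoint O} ⊆ S' →
      Ch X'' (τ ≫ σ') (closure (τ ⁻¹' (S' \ (C.support : Set X')))))
    (hq : Smooth q) (hqp : IsProper q)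
    (hY : (Y : Set P) ⊆ q ⁻¹' {IsLocalRing.closedPoint O}) (hYirr : IsIrreducible (Y : Set P))
    -- the upstairs stage
    (X₁ : Scheme.{0}) (σ₁ : X₁ ⟶ P) (S₁ : Set X₁) (hCh : Ch X₁ σ₁ S₁)
    (hgoodS : GoodSet (σ₁ ≫ q) S₁)
    -- the downstairs start, identified with the stage
    (F₀ : Scheme.{0}) [IsLocallyNoetherian F₀] (T₀ : Set F₀) (hT₀cl : IsClosed T₀) (hT₀irr : IsIrreducible T₀)
    (e : (vanishingIdeal (⟨closure T₀, isClosed_closure⟩ : Closeds F₀)).subscheme ≅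
      (vanishingIdeal (⟨closure S₁, isClosed_closure⟩ : Closeds X₁)).subscheme)
    -- the downstairs point-only resolution
    (hres : ∃ (F' : Scheme.{0}) (ρ' : F' ⟶ F₀) (T' : Set F'),
      (∀ Q : (∀ F₁ : Scheme.{0}, (F₁ ⟶ F₀) → Set F₁ → Prop), Q F₀ (𝟙 F₀) T₀ →
        (∀ (F₁ F₂ : Scheme.{0}) (ρ : F₁ ⟶ F₀) (T₁ : Set F₁)
          (x : ↥(vanishingIdeal (⟨closure T₁, isClosed_closure⟩ : Closeds F₁)).subscheme) (υ : F₂ ⟶ F₁)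
          (hx : IsClosed ({((vanishingIdeal (⟨closure T₁, isClosed_closure⟩ : Closeds F₁)).subschemeι x : F₁)} : Set F₁)),
          Q F₁ ρ T₁ →
          ¬ IsRegularLocalRing ((vanishingIdeal (⟨closure T₁, isClosed_closure⟩ : Closeds F₁)).subscheme.presheaf.stalk x) →
          IsBlowup υ (vanishingIdeal
            (⟨{((vanishingIdeal (⟨closure T₁, isClosed_closure⟩ : Closeds F₁)).subschemeι x : F₁)}, hx⟩ : Closeds F₁)) →
          Q F₂ (υ ≫ ρ) (closure (υ ⁻¹' (T₁ \
            {((vanishingIdeal (⟨closure T₁, isClosed_closure⟩ : Closeds F₁)).subschemeι x : F₁)})))) →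
        Q F' ρ' T') ∧
      Scheme.IsRegular (vanishingIdeal (⟨closure T', isClosed_closure⟩ : Closeds F')).subscheme) :
    ∃ (X₂ : Scheme.{0}) (σ₂ : X₂ ⟶ P) (S₂ : Set X₂),
      Ch X₂ σ₂ S₂ ∧ GoodSet (σ₂ ≫ q) S₂ ∧
      Scheme.IsRegular (vanishingIdeal (⟨closure S₂, isClosed_closure⟩ : Closeds X₂)).subscheme := by
  classical
  -- adapted from `pointResolution_from_stage` (Theorems/EquisingularLiftEquisingularLiftNatPointResolutionRel.lean): the downstairs
  -- induction predicate now carries `GoodSet` instead of «irreducible special fibre ∧ good reduction everywhere»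
  let QD : ∀ F₁ : Scheme.{0}, (F₁ ⟶ F₀) → Set F₁ → Prop :=
    fun F₁ _ T₁ => IsClosed T₁ ∧ IsLocallyNoetherian F₁ ∧ IsIrreducible T₁ ∧
      ∃ (X' : Scheme.{0}) (σ' : X' ⟶ P) (S' : Set X'),
        Ch X' σ' S' ∧ GoodSet (σ' ≫ q) S' ∧
        Nonempty ((vanishingIdeal (⟨closure T₁, isClosed_closure⟩ : Closeds F₁)).subscheme ≅
          (vanishingIdeal (⟨closure S', isClosed_closure⟩ : Closeds X')).subscheme)
  obtain ⟨F', ρ', T', hclos, hregD⟩ := hres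
  have hQD : QD F' ρ' T' := by
    refine hclos QD ?_ ?_
    · -- BASE: the given stage
      exact ⟨hT₀cl, inferInstance, hT₀irr, X₁, σ₁, S₁, hCh, hgoodS, ⟨e⟩⟩
    · -- STEP: `pointStep_of_goodSet`
      intro F₁ F₂ ρ T₁ x υ hx hQ₁ hxreg hυ
      obtain ⟨hT₁cl, hF₁, hT₁irr, X', σ', S', hChX, hgoodX, ⟨eX⟩⟩ := hQ₁
      haveI := hF₁
      obtain ⟨X'', σ'', S'', hCh'', hgood'', hF₂, hT₂irr, hiso⟩ :=
        pointStep_of_goodSet O P q Y Ch hChain hStep hq hqp hY hYirr X' σ' S' hChX hgoodX F₁ F₂ T₁ hT₁cl hT₁irr x hx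
          hxreg υ hυ eX
      exact ⟨isClosed_closure, hF₂, hT₂irr, X'', σ'', S'', hCh'', hgood'', hiso⟩
  -- THE END: transport the downstairs regularity through the isomorphism
  obtain ⟨-, -, -, X₂, σ₂, S₂, hCh₂, hgood₂, ⟨e₂⟩⟩ := hQD
  exact ⟨X₂, σ₂, S₂, hCh₂, hgood₂, Scheme.IsRegular.of_iso e₂.hom hregD⟩

/-! ## Piece B1 of the point-exit cut, by name -/

/-- **PIECE B1 — GOOD-POINT FINISH — holds** (every prime `p`, every `n`, every hypersurface): `GoodPointFinish p`
(Theorems/EquisingularLiftEquisingularLiftNatPointExit.lean, res-L1-w45b-strat-1) BY NAME. Unpack `GoodPointFinishAt`/`ExitAt`/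
`PtResolvable`; the residue field of `O` is algebraically closed (`π : O ↠ k`); `Y = range (ι ≫ Proj.map φ)` is closed irreducible in
the special fibre of the smooth proper integral `ℙⁿ_O`; the downstairs `T₀` is irreducible because `V(closure T₀)_red ≅ V(closure S₁)_red`
and `closure S₁ = closure {ξ₁}` along the chain; then `pointResolution_from_stage_of_goodSet` with the stage predicate «reachable from
the base AND from the stage» (as in `finish_of_exit_of_goodAll`). With `stub_elnat_ge_four_finish_of_exit` this reduces the registered
stub `stub_elnat_ge_four_finish` (`GeFourFinishIsolated p`) to piece B2 `GeFourReachExitIsolated p`. [folklore; Liu 2002 §8.1, §8.3.4] -/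
theorem goodPointFinish_holds (p : ℕ) :
    Summit.ResolutionOfSingularities.ResolutionOfSingularities.Theorems.EquisingularLiftNatPointExit.GoodPointFinish p := by
  classical
  intro _ k _ _ _ n H ι hι hH _ O _ _ _ _ _ π hπ
  letI := MvPolynomial.gradedAlgebra (σ := Fin (n + 1)) (R := O)
  letI := MvPolynomial.gradedAlgebra (σ := Fin (n + 1)) (R := k)
  intro φ hφ' hφ Y hYdef X₁ σ₁ S₁ hH₁ hExit
  haveI : IsAlgClosed (IsLocalRing.ResidueField O) := isAlgClosed_residueField_of_surjective π hπ
  -- the base `ℙⁿ_O`: smooth, proper, integral; the comparison `g : ℙⁿ_k → ℙⁿ_O` is a closed immersion onto the special fibre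
  have hP := ProjectiveAmbientFibre.isPullback_projMap π φ hφ hπ hφ'
  haveI : IsClosedImmersion (Spec.map (CommRingCat.ofHom π)) := IsClosedImmersion.spec_of_surjective _ hπ
  haveI hgci : IsClosedImmersion (Proj.map φ hφ') := MorphismProperty.IsStableUnderBaseChange.of_isPullback hP.flip inferInstance
  have hpt : ∀ x : Spec (.of k), Spec.map (CommRingCat.ofHom π) x = IsLocalRing.closedPoint O := by
    intro x
    rw [Spec.map_apply]
    apply PrimeSpectrum.ext
    rw [PrimeSpectrum.comap_asIdeal, CommRingCat.hom_ofHom, Ideal.eq_bot_of_prime x.asIdeal, ← RingHom.ker_eq_comap_bot]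
    exact IsLocalRing.eq_maximalIdeal (RingHom.ker_isMaximal_of_surjective π hπ)
  have hgq : ∀ x, (AlgebraicGeometry.Proj.toSpecZero (MvPolynomial.homogeneousSubmodule (Fin (n + 1)) O) ≫ AlgebraicGeometry.Spec.map (CommRingCat.ofHom (algebraMap O (MvPolynomial.homogeneousSubmodule (Fin (n + 1)) O 0)))) (Proj.map φ hφ' x) = IsLocalRing.closedPoint O := fun x ↦
    (Scheme.Hom.comp_apply (Proj.map φ hφ') (AlgebraicGeometry.Proj.toSpecZero (MvPolynomial.homogeneousSubmodule (Fin (n + 1)) O) ≫ AlgebraicGeometry.Spec.map (CommRingCat.ofHom (algebraMap O (MvPolynomial.homogeneousSubmodule (Fin (n + 1)) O 0)))) x).symm.trans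
      ((congrArg (fun h : Proj (MvPolynomial.homogeneousSubmodule (Fin (n + 1)) k) ⟶ Spec (.of O) ↦ h x) hP.w).trans
        ((Scheme.Hom.comp_apply _ _ x).trans (hpt _)))
  haveI := hH
  let ι' : H ⟶ Proj (MvPolynomial.homogeneousSubmodule (Fin (n + 1)) k) := ι
  haveI : IsClosedImmersion ι' := hι
  let f : H ⟶ (Proj (MvPolynomial.homogeneousSubmodule (Fin (n + 1)) O)) := ι' ≫ Proj.map φ hφ'
  let Yc : Closeds (Proj (MvPolynomial.homogeneousSubmodule (Fin (n + 1)) O)) := ⟨Set.range f, f.isClosedEmbedding.isClosed_range⟩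
  have hsub : (Yc : Set (Proj (MvPolynomial.homogeneousSubmodule (Fin (n + 1)) O))) ⊆ (AlgebraicGeometry.Proj.toSpecZero (MvPolynomial.homogeneousSubmodule (Fin (n + 1)) O) ≫ AlgebraicGeometry.Spec.map (CommRingCat.ofHom (algebraMap O (MvPolynomial.homogeneousSubmodule (Fin (n + 1)) O 0)))) ⁻¹' {IsLocalRing.closedPoint O} := by
    rintro _ ⟨x, rfl⟩
    show (AlgebraicGeometry.Proj.toSpecZero (MvPolynomial.homogeneousSubmodule (Fin (n + 1)) O) ≫ AlgebraicGeometry.Spec.map (CommRingCat.ofHom (algebraMap O (MvPolynomial.homogeneousSubmodule (Fin (n + 1)) O 0)))) (f x) = IsLocalRing.closedPoint O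
    rw [show f x = Proj.map φ hφ' (ι' x) from Scheme.Hom.comp_apply _ _ x]
    exact hgq (ι' x)
  have hYirr : IsIrreducible (Yc : Set (Proj (MvPolynomial.homogeneousSubmodule (Fin (n + 1)) O))) := by
    have h := (IrreducibleSpace.isIrreducible_univ H).image f f.continuous.continuousOn
    rwa [Set.image_univ] at h
  obtain ⟨hsm, hprop⟩ := stub_projectiveAmbientSmoothProper O n
  haveI := hprop
  haveI : IsIntegral (Proj (MvPolynomial.homogeneousSubmodule (Fin (n + 1)) O)) := Proj.isIntegral _ (irrelevant_homogeneousSubmodule_ne_bot n O)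
  haveI : IsNoetherianRing (CommRingCat.of O) := inferInstanceAs (IsNoetherianRing O)
  haveI : IsLocallyNoetherian (Proj (MvPolynomial.homogeneousSubmodule (Fin (n + 1)) O)) := LocallyOfFiniteType.isLocallyNoetherian (AlgebraicGeometry.Proj.toSpecZero (MvPolynomial.homogeneousSubmodule (Fin (n + 1)) O) ≫ AlgebraicGeometry.Spec.map (CommRingCat.ofHom (algebraMap O (MvPolynomial.homogeneousSubmodule (Fin (n + 1)) O 0))))
  -- unpack the exit condition; the downstairs `T₀` is irreducible through the isomorphism with `V(closure S₁)_red`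
  obtain ⟨hgoodS, F₀, hF₀, T₀, hT₀cl, ⟨e⟩, hres⟩ := hExit
  haveI := hF₀
  subst hYdef
  have hch : Chain (Proj (MvPolynomial.homogeneousSubmodule (Fin (n + 1)) O)) (Yc : Set (Proj (MvPolynomial.homogeneousSubmodule (Fin (n + 1)) O))) X₁ σ₁ S₁ := chain_of_horizChainE1 (AlgebraicGeometry.Proj.toSpecZero (MvPolynomial.homogeneousSubmodule (Fin (n + 1)) O) ≫ AlgebraicGeometry.Spec.map (CommRingCat.ofHom (algebraMap O (MvPolynomial.homogeneousSubmodule (Fin (n + 1)) O 0)))) (Yc : Set (Proj (MvPolynomial.homogeneousSubmodule (Fin (n + 1)) O))) σ₁ S₁ hH₁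
  obtain ⟨ξ, hξ⟩ : ∃ ξ : (Proj (MvPolynomial.homogeneousSubmodule (Fin (n + 1)) O)), IsGenericPoint ξ (Yc : Set (Proj (MvPolynomial.homogeneousSubmodule (Fin (n + 1)) O))) := QuasiSober.sober hYirr Yc.isClosed
  obtain ⟨ξ₁, -, hS₁⟩ := Chain.fibre hch hξ
  have hS₁irr : IsIrreducible (closure S₁) := by
    rw [hS₁, closure_closure]; exact isIrreducible_singleton.closure
  haveI : IsIntegral (vanishingIdeal (⟨closure S₁, isClosed_closure⟩ : Closeds X₁)).subscheme :=
    ComponentGluing.isIntegral_subscheme_vanishingIdeal _ hS₁irr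
  haveI : IsIntegral (vanishingIdeal (⟨closure T₀, isClosed_closure⟩ : Closeds F₀)).subscheme := IsIntegral.of_isIso e.inv
  have hT₀irr : IsIrreducible T₀ := by
    rw [← isIrreducible_iff_closure]
    have hr : Set.range (vanishingIdeal (⟨closure T₀, isClosed_closure⟩ : Closeds F₀)).subschemeι = closure T₀ := by
      rw [AlgebraicGeometry.Scheme.IdealSheafData.range_subschemeι, AlgebraicGeometry.Scheme.IdealSheafData.coe_support_vanishingIdeal]; rfl
    rw [← hr, ← Set.image_univ]
    exact (IrreducibleSpace.isIrreducible_univ _).image _ (Scheme.Hom.continuous _).continuousOn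
  -- T-ISO-0-REL in `GoodSet` currency, with the stage predicate «reachable from the base and from the stage»
  obtain ⟨X₂, σ₂, S₂, ⟨-, h₂⟩, -, hreg₂⟩ := pointResolution_from_stage_of_goodSet O (Proj (MvPolynomial.homogeneousSubmodule (Fin (n + 1)) O)) (AlgebraicGeometry.Proj.toSpecZero (MvPolynomial.homogeneousSubmodule (Fin (n + 1)) O) ≫ AlgebraicGeometry.Spec.map (CommRingCat.ofHom (algebraMap O (MvPolynomial.homogeneousSubmodule (Fin (n + 1)) O 0)))) Yc
    (fun X' σ' S' => HReach (AlgebraicGeometry.Proj.toSpecZero (MvPolynomial.homogeneousSubmodule (Fin (n + 1)) O) ≫ AlgebraicGeometry.Spec.map (CommRingCat.ofHom (algebraMap O (MvPolynomial.homogeneousSubmodule (Fin (n + 1)) O 0)))) (Yc : Set (Proj (MvPolynomial.homogeneousSubmodule (Fin (n + 1)) O))) (Proj (MvPolynomial.homogeneousSubmodule (Fin (n + 1)) O)) (𝟙 (Proj (MvPolynomial.homogeneousSubmodule (Fin (n + 1)) O))) (Yc : Set (Proj (MvPolynomial.homogeneousSubmodule (Fin (n + 1)) O))) X' σ' S' ∧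 HReach (AlgebraicGeometry.Proj.toSpecZero (MvPolynomial.homogeneousSubmodule (Fin (n + 1)) O) ≫ AlgebraicGeometry.Spec.map (CommRingCat.ofHom (algebraMap O (MvPolynomial.homogeneousSubmodule (Fin (n + 1)) O 0)))) (Yc : Set (Proj (MvPolynomial.homogeneousSubmodule (Fin (n + 1)) O))) X₁ σ₁ S₁ X' σ' S')
    (fun X' σ S h => chain_of_horizChainE1 (AlgebraicGeometry.Proj.toSpecZero (MvPolynomial.homogeneousSubmodule (Fin (n + 1)) O) ≫ AlgebraicGeometry.Spec.map (CommRingCat.ofHom (algebraMap O (MvPolynomial.homogeneousSubmodule (Fin (n + 1)) O 0)))) (Yc : Set (Proj (MvPolynomial.homogeneousSubmodule (Fin (n + 1)) O))) σ S h.1)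
    (fun X' X'' σ' S' C τ h hb hr hfl hg hE => ⟨hReach_step C τ h.1 hb hr hfl hg hE, hReach_step C τ h.2 hb hr hfl hg hE⟩)
    hsm hprop hsub hYirr X₁ σ₁ S₁ ⟨hH₁, hReach_refl X₁ σ₁ S₁⟩ hgoodS F₀ T₀ hT₀cl hT₀irr e hres
  exact ⟨X₂, σ₂, S₂, h₂, hreg₂⟩

end Summit.ResolutionOfSingularities.ResolutionOfSingularities.Cruxes.EquisingularLiftNat.Sections

end
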